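import Summits.ResolutionOfSingularities.ResolutionOfSingularities.Theorems.HilbertSamuelEliminationSigmaMaxModificationsCorridor3QuadraticTransformFibre
import Literature.AlgebraicGeometry.Resolution.OneDimensionalBlowupTower
import HarnessLib

/-!
# Route `HilbertSamuelElimination`, crux `SigmaMaxModificationsCorridor3`
# (stmt-ResolutionOfSingularities-19249; child of `SigmaMaxModifications` stmt-…-18506),
# line `tame_wild` v3 — TERMINATION INPUT over codimension-one points: Krull's blow-up tower

[OURS · L1 W4.2] Brick W2 of the FC-R1 assembly plan (HOME `L/res-L1-w42-stub-3/FCR1-PLAN.md`):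
the printed theorem that makes the confinement rounds (`exists_centreSeq_round`, p482115)
terminate over the codimension-one points of the stratum — Krull 1930 (Satz 7) in Kollár's form,
*Lectures on Resolution of Singularities* (2007), Thm. 1.101 with Def. 1.97, Lemma 1.99 and
Algorithm 1.100 (pp. 57–59): for a one-dimensional Noetherian (semi-)local ring `S` with reduced
completion, the tower `S₀ = S`, `S_{i+1} = B S_i` (blow up all closed points) stabilises after
finitely many steps at regular rings — a NAMED FACT of the tree (`Literature.AlgebraicGeometry.Resolution.Kollar2007_thm_1_101_localChain`,
`OneDimensionalBlowupTower.lean`, p485648; taken as a hypothesis by FC-R1, not discharged), in the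
LOCAL CHAIN form the rounds consume: every chain of successive local quadratic transforms of `A` reaches a regular ring
by a stage `m = m(A)`. (A chain member is the local ring at a point over the closed point of a
blow-up along a centre whose stalk at the tracked point is the maximal ideal; by p484342
`exists_point_affineBlowup_of_stalkIdeal_eq_maximalIdeal` — blowing up commutes with the flat base
change `Spec 𝒪_{X,x} → X`, Görtz–Wedhorn 13.91 (2) — these are exactly the localizations of
Kollár's `S_i` at its closed points, so the chain form is the printed statement read pointwise.)
The domain case is essentially in the tree (Herrmann–Ikeda–Orbanz (30.2):
`exists_quadraticSeq_eq_valuationSubring`; the `δ`-drop `IsBlowup.sum_curveDelta_fibre_lt`); the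
reduced non-domain case (a stratum surface lying on two components of the threefold) is the debt.

* `exists_quadraticChain_bound_stalk` — its instance for the local ring of an excellent reduced
  scheme at a point of codimension one (the completion is reduced: the local rings of an excellent
  scheme are G-rings, `IsGRing.isReduced_adicCompletion`).

NOT a statement of any manuscript; AI-written, weaker than expert review.

## Sources

* J. Kollár, *Lectures on Resolution of Singularities*, Ann. of Math. Stud. 166 (2007), Def. 1.97,
  Lemma 1.99, Algorithm 1.100, Thm. 1.101 (pp. 57–59). [Kollar2007]
* W. Krull, *Ein Satz über primäre Integritätsbereiche*, Math. Ann. 103 (1930), Satz 7 — as cited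
  by Kollár ([Kru30, Satz 7]). [Kollar2007]
* U. Görtz, T. Wedhorn, *Algebraic Geometry I* (2020), Prop. 13.91 (2). [GortzWedhorn2020]
-/

set_option linter.dupNamespace false -- mandated namespace of this single-conjunct summit

noncomputable section

open CategoryTheory CategoryTheory.Limits AlgebraicGeometry TopologicalSpace Topology IsLocalRing
open Literature.AlgebraicGeometry.Resolution Literature.RingTheory.HilbertSamuel

namespace Summit.ResolutionOfSingularities.ResolutionOfSingularities.Theorems.SigmaMaxModificationsCorridor3.Helpers

universe u

/-- **The bound for the local ring of an excellent reduced scheme at a codimension-one point**: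
`𝒪_{Y,η}` is a one-dimensional Noetherian local ring with reduced completion (the local rings of an
excellent scheme are G-rings, and a reduced local G-ring is analytically unramified:
`IsGRing.isReduced_adicCompletion`), so the named fact applies to it.
[cite: Kollar2007, Thm. 1.101 (p. 58)] [cite: StacksProject, Tag 07QK] -/
theorem exists_quadraticChain_bound_stalk (hK : Kollar2007_thm_1_101_localChain.{u})
    {Y : Scheme.{u}} [IsLocallyNoetherian Y] [IsReduced Y] (hexc : Scheme.IsExcellent Y) {η : Y}
    (hη : ringKrullDim (Y.presheaf.stalk η) = 1) :
    ∃ m : ℕ, ∀ R : ℕ → CommRingCat.{u}, Nonempty (R 0 ≅ Y.presheaf.stalk η) →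
      (∀ i, i < m → ∃ (X X' : Scheme.{u}) (π : X' ⟶ X) (D : X.IdealSheafData) (x : X) (x' : X'),
        IsBlowup π D ∧ stalkIdeal D x = maximalIdeal (X.presheaf.stalk x) ∧ π.base x' = x ∧
          Nonempty (X.presheaf.stalk x ≅ R i) ∧ Nonempty (X'.presheaf.stalk x' ≅ R (i + 1))) →
      ∃ i, i ≤ m ∧ IsRegularLocalRing (R i) := by
  have hG : IsGRing (Y.presheaf.stalk η) :=
    Scheme.isGRing_stalk_of_isQuasiExcellent hexc.isQuasiExcellent η
  have hred : IsReduced (AdicCompletion (maximalIdeal (Y.presheaf.stalk η)) (Y.presheaf.stalk η)) :=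
    hG.isReduced_adicCompletion
  exact hK (Y.presheaf.stalk η) hη hred

end Summit.ResolutionOfSingularities.ResolutionOfSingularities.Theorems.SigmaMaxModificationsCorridor3.Helpers

end
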